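import Summits.QuantumFields.YangMills.Theorems.UnitScaleTiltHalvingP1FlatCoreTopStepFamily
import Summits.QuantumFields.YangMills.Theorems.UnitScaleTiltHalvingP1FlatCoreTopDictionary
import Summits.QuantumFields.YangMills.Theorems.UnitScaleTiltProp8ChartDoubleBarDefs
import Literature.MathematicalPhysics.QuantumFieldTheory.Balaban1983to89.B8Eq1123Concrete
import HarnessLib

/-!
# Line H (`BirthV10.stub_halvingStep`, stmt-QuantumFields-19200), J4c **(T4b) FILE 2: THE TOP-STEP INSTANCE** of ✓`HalvingP1FlatCoreTopStep.hFP_kLevel_family_RD`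
# — Proposition 5's k-level fixed point AT THE FLAT BACKGROUND with the lower levels' remainder = N05's concrete `C′_j(u₁⁻¹, ·)` and the TOP member =
# the torus effective-gauge tower of the charted iterate read through the window representative; output: (lo) print's (1.79) below the top and
# (top) the (o)-identity «top effective gauge of the correction = axial gauge of the double-bar top field» on ALL top index sites

Cell `ym3-torus` (HUMAN RULING D-0037: YM₃ on T³ is ladder rung R3, NOT the Clay problem), width seat `ym-ust-19936-w8` gen 2 (LEAD-H ★w5-19200 g4 12:09:54Z
«(T4b) → ★w8-19936 g2»; 12:30:56Z Q3: (lo) as the socket emits it, (top) on ALL of `Λs k`, J7 `dp1Clause_of_top` = ★w7-19936 g4 ✓p634561 consumes (top)).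
`--supports stmt-QuantumFields-19200 --as helper`; THEOREMS ONLY (0 `def`, 0 `sorry`); count-neutral; nothing here claims `core′`, the stub, the crux or the gap.

WHAT.  ★★★ `hFP_kLevel_top_RD` — ✓p632037 `hFP_kLevel_family_RD` (restriction-agnostic JOIN-B at the Sect. E correction of an abstract family, ★w3-19936 g6 ∕
★w8 s2) INSTANTIATED at background `U₀ = 1` with
* `Qlin j := QprimeIter (zdBlocking d L) (bgT L 1) j` (N05's linear restriction functional; `hQH`, `hq` in JOIN-C's letters ✓`B8Prop5JoinSectE.hFP_kLevel_of_sectE` :554∕:538);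
* `Qfull j μ := Qnl L 1 (expUnit ∘ μ) u₁⁻¹ j`, `Cfam j := Cnl L 1 u₁⁻¹ j` for `j < k` ([Balaban1985RegularSpaces] (1.79)∕(1.113) at the INVERSE lower gauge,
  N05's ORDER ruling (a″)); their rows (1.121)∕(1.125)∕reality at `j < k` DISPLAYED in the socket's shape (suppliers ✓`B8SectEInLambdaWitness.norm_Cnl_le_tower_of_witness` ∕
  `lipschitz_Cnl_tower_of_witness` ∕ ✓`B8SectERemainderCovariance.Cnl_negStar_inv_of_axial` from N05's induction invariants — dag-n05-c (T2));
* `Qfull k μ yc := log κf[μ ∘ rep]_k(π_k yc)`, `Cfam k μ yc := log κf[μ ∘ rep]_k(π_k yc) − (Q′_k (μ ∘ rep))(π_k yc)` — the TORUS effective-gauge tower `κf` of the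
  double-bar tower of the charted iterate `W₁` (F3 ✓p633797 `exists_effGaugeFun`: recursion `hs`, bottom `h0`), read on `ℤᵈ` through the window representative `rep`
  (`hrep`: `rep ∘ π = id` on the tower boxes of the top index sites — J1b∕J6∕Q4 row) and the level-`k` cover `π_k = Node00.coverAt` — with its three rows DISPLAYED IN
  TORUS LETTERS on the `ℤᵈ` tower box (`hTop121`∕`hTop125`∕`hTopReal` = the conclusions of ★w3-19936 g6's F2∕F3∕F4-local at the site family under `π_k yc`, composed
  with ✓`P1FlatCoreTopDictionary.norm_siteAvgIter_coverAt_sub_le`; FILE 3 discharges them by name);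
* `th` the (o)-target: any `th : XSpace` vanishing below the top with `th (k, yc) = log v₀(U̿^{(k)}W₁; y₀, π_k yc)` (`hthk`∕`hthlo`; built by ✓`P1FlatCoreTopDictionary.exists_topTarget`,
  skew by [Balaban1985Averaging] (21) for unitaries, `‖th‖ ≤ 8mδ′` by ✓`P1FlatCoreDP1Target.norm_mlog_axialT_le`).
CONCLUSION: the socket's `λ′` (Hermitian, `= 0` off `Ω₀`, (1.108) on `Eb j`, multiplier form of the Landau equation on `Ω₀`) with the last conjunct SPLIT:
(lo) `Qnl L 1 (expUnit ∘ ((−I)•λ′)) u₁⁻¹ j y = 0` on `Λs j`, `j < k` (print's (1.79) below the top ⇒ (1.29) by ✓`restr129_mul_of_cond179_inv`, nobody re-threads — LEAD-H Q3);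
(top) `κf (((−I)•λ′) ∘ rep) k (π_k yc) = axialT (U̿^{(k)}W₁) y₀ (π_k yc)` for every `yc ∈ Λs k` — the `htop` of ✓p634561 `HalvingP1FlatCoreDP1OfTop.dp1Clause_of_top`.
HONEST SCOPE.  By-name instantiation + the `ℤᵈ`∕torus identifications (`h213` at the top = ✓(S2), `hlin` = ✓`QprimeIter_add`∕`_smul`, `cj 1 = id`); every analytic
row stays DISPLAYED (lower: N05's; top: torus letters); nothing of [Balaban1985RegularSpaces] Prop. 5 ∕ Sect. E, of `core′`, the stub or the crux is proved here.

References: T. Bałaban, CMP **99** (1985) 75–102 [Balaban1985RegularSpaces] (Prop. 5 (1.107)–(1.109) p.94, (1.113)–(1.121) pp.95–96, (1.79) p.90); CMP **98** (1985)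
17–51 [Balaban1985Averaging] ((97)–(100) p.32, (208)–(214) p.50, (21) p.21); CMP **102** (1985) 277–309 [Balaban1985Variational] ((156) p.302).
-/

set_option autoImplicit false

noncomputable section

open scoped BigOperators
open NormedSpace Metric Set
open Complex (I)

namespace Summit.QuantumFields.YangMills.Theorems.P1FlatCoreTopStepTorus

open Literature.MathematicalPhysics.QuantumFieldTheory.Balaban1983to89
open T4Continuum
open MatrixLog (mlog)
open B7Prop1Explicit (e expUnit)
open B7Prop2Explicit (unitaryUnits)
open B7Eq78Linearization (conjR QprimeIter zdBlocking QprimeIter_add QprimeIter_smul)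
open B7Eq170Flat (cj cj_apply)
open B7Prop1Local (InBox)
open B8Ineq130 (tlo thi)
open B8Ineq132 (covDerivFwd)
open B8Eq138LandauZd (covLap covDivB QT)
open B8Eq182Proof (gAd)
open B8Eq184Proof (gaugeExp)
open B8Eq188Proof (frakF3)
open B8Eq1117Concrete (XSpace)
open B8LambdaSpaceKLevel (wt)
open B8Prop5ContractionKLevel (Bd2 Mc Kc)
open B8Eq119TwistedAxial (bgT)
open B8Eq178Averages (Qnl)
open B8Eq1123Concrete (Cnl)
open B15Eq112TorusCover (cover)
open B14DomainGeom (Pt)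
open Node00 (coverAt)
open LatticeFieldCalculus (siteAvgIter)
open Literature.MathematicalPhysics.QuantumLattice (blockSites)
open B10Eq27TorusAxialLog (gaugeActT axialT)
open Summit.QuantumFields.YangMills.Theorems.Prop8ChartDoubleBar (vframeU dbarIterU)
open Summit.QuantumFields.YangMills.Theorems.HalvingP1FlatCoreTopStep (hFP_kLevel_family_RD)
open Summit.QuantumFields.YangMills.Theorems.P1FlatCoreTopDictionary (siteAvgIter_comp_rep_coverAt_eq_qprimeIter inBox_tlo_thi_iff_mem_blockSites)

-- `Site` alone could resolve to the torus sites; N05's carriers are `Fin d → ℤ`.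
open B7Prop1Explicit (Site)

variable {P : Params} {𝔸 : Type*} [CStarAlgebra 𝔸] [Nontrivial 𝔸]

/-! ## §1 Plumbing at the flat background -/

omit [Nontrivial 𝔸] in
/-- `cj 1 = id`: the covariant gradient of the socket's (1.120)-rows at the flat background is the plain lattice gradient. [folklore] -/
theorem cj_one_apply (X : 𝔸) : cj (1 : 𝔸ˣ) X = X := by
  rw [cj_apply, Units.val_one, inv_one, Units.val_one, one_mul, mul_one]

omit [Nontrivial 𝔸] in
/-- N05's linear restriction functional is subtractive (✓`QprimeIter_add` + ✓`QprimeIter_smul`). [cite: Balaban1985Averaging, (212) p.50] -/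
theorem qprimeIter_sub {ι : Type*} (G : B7Eq78Linearization.Blocking ι) (T : ℕ → ι → ι → 𝔸ˣ) (j : ℕ) (μ₁ μ₂ : ι → 𝔸) (y : ι) :
    QprimeIter G T j (μ₁ - μ₂) y = QprimeIter G T j μ₁ y - QprimeIter G T j μ₂ y := by
  have h1 : μ₁ - μ₂ = fun x => μ₁ x + (fun z => (-1 : ℂ) • μ₂ z) x := by
    funext x; simp [sub_eq_add_neg]
  rw [h1, QprimeIter_add, QprimeIter_smul]
  simp [sub_eq_add_neg]

/-! ## §2 The top-step instance -/

/-- ★★★ **PROPOSITION 5's TOP STEP FOR THE H-LINE: the J4c socket at the flat background with N05's lower remainders and the TORUS top member.**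
See the module docstring for the instance; binders in five blocks: (A) the socket's JOIN-B∕H′∕datum∕window letters VERBATIM at `U₀ = 1` (`d := P.d`, `L := P.L`);
(B) N05's linear functional rows `hQH`∕`hq`; (C) the lower family's rows at `j < k` in the socket's shape; (D) the torus side: the charted iterate's effective-gauge
tower `κf` (`hs`∕`h0` = ✓`exists_effGaugeFun`'s letters), the representative `rep` with `hrep`, the target `th` with `hthk`∕`hthlo`, the near-`1` clause `haxT` of the axial
top gauge; (E) the three top rows in torus letters on the tower box.  Output: `λ′` with (sa), support, (1.108), multiplier form, (lo) and (top).
[cite: Balaban1985RegularSpaces, Prop. 5 (1.107)–(1.109) p.94, (1.113)–(1.121) pp.95–96, (1.79) p.90; Balaban1985Averaging, (97)–(100) p.32, (208)–(214) p.50] -/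
theorem hFP_kLevel_top_RD {k : ℕ} (hk : k ≤ P.m + P.K) {η : ℝ} {Ω Λs : ℕ → Set (Site P.d)} {Eb : ℕ → Set (Site P.d × Fin P.d)}
    {A : Site P.d → Fin P.d → 𝔸}
    (hη : 0 < η)
    (hEbΩ : ∀ j, j ≤ k → ∀ x ∈ Ω j, ∀ μ : Fin P.d, (x, μ) ∈ Eb j ∧ (x - e μ, μ) ∈ Eb j)
    (hEbT : ∀ j, j ≤ k → ∀ y ∈ Λs j, ∀ (x : Site P.d) (κ : Fin P.d), InBox (tlo P.L y j) (thi P.L y j) x →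
      InBox (tlo P.L y j) (thi P.L y j) (x + e κ) → (x, κ) ∈ Eb j)
    -- (A) letters of [4] (RD form) at the flat background
    (g Δ : (Site P.d → 𝔸) →ₗ[ℂ] (Site P.d → 𝔸)) (q : (Site P.d → 𝔸) →ₗ[ℂ] (ℕ → Site P.d → 𝔸))
    (qs : (ℕ → Site P.d → 𝔸) →ₗ[ℂ] (Site P.d → 𝔸)) (Aw c : (ℕ → Site P.d → 𝔸) →ₗ[ℂ] (ℕ → Site P.d → 𝔸))
    (g_rightΩ : ∀ x, ∀ y ∈ Ω 0, (Δ (g x) + qs (Aw (q (g x)))) y = x y)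
    (c_range : ∀ f, q (g (g (qs (c (q f))))) = q f)
    (hΔ : ∀ (f : Site P.d → 𝔸), ∀ x ∈ Ω 0, Δ f x = covLap η (1 : Site P.d → Fin P.d → 𝔸ˣ) ((Ω 0).indicator f) x)
    (hqs : ∀ (μ : ℕ → Site P.d → 𝔸), ∀ x ∈ Ω 0, qs μ x = QT P.L k Λs (1 : Site P.d → Fin P.d → 𝔸ˣ) μ x)
    (H' : XSpace P.d k 𝔸 →ₗ[ℂ] (Site P.d → 𝔸))
    {α₄ B₀' B₂' Cb Cl BG BR cA cDA : ℝ}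
    (hα₄ : 0 < α₄) (hB : 0 < B₀') (hB₂ : 0 ≤ B₂') (hCb : 0 ≤ Cb) (hCl : 0 ≤ Cl)
    (hH0 : ∀ (X : XSpace P.d k 𝔸) (x : Site P.d), ‖H' X x‖ ≤ B₀' * ‖X‖)
    (hH1 : ∀ j, j ≤ k → ∀ (X : XSpace P.d k 𝔸), ∀ p ∈ Eb j,
      wt P.L η j * ‖covDerivFwd η (1 : Site P.d → Fin P.d → 𝔸ˣ) p.2 (H' X) p.1‖ ≤ B₀' * ‖X‖)
    (hH2 : ∀ X : XSpace P.d k 𝔸, Bd2 P.L η k Ω (covLap η (1 : Site P.d → Fin P.d → 𝔸ˣ) (H' X)) (B₂' * ‖X‖))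
    (hHsupp : ∀ (X : XSpace P.d k 𝔸) (x : Site P.d), x ∉ Ω 0 → H' X x = 0)
    (hHequiv : ∀ X Y : XSpace P.d k 𝔸, (∀ p, Y p = -star (X p)) → ∀ x, H' Y x = -star (H' X x))
    (hCbρ : Cb ≤ α₄ / (2 * B₀')) (hClB : Cl * B₀' ≤ 1 / 2)
    (hBG : 0 ≤ BG) (hBR : 0 ≤ BR) (hcA : 0 ≤ cA) (hcA' : cA ≤ 1 / 13) (hcDA : 0 ≤ cDA)
    (hG : ∀ (f : Site P.d → 𝔸) (m : ℝ), 0 ≤ m → Bd2 P.L η k Ω f m →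
      (∀ x, ‖g f x‖ ≤ BG * m) ∧ ∀ j, j ≤ k → ∀ p ∈ Eb j,
        wt P.L η j * ‖covDerivFwd η (1 : Site P.d → Fin P.d → 𝔸ˣ) p.2 (g f) p.1‖ ≤ BG * m)
    (hGsupp : ∀ (f : Site P.d → 𝔸) (x : Site P.d), x ∉ Ω 0 → g f x = 0)
    (hGreal : ∀ f : Site P.d → 𝔸, (∀ j, j ≤ k → ∀ x ∈ Ω j, IsSelfAdjoint (f x)) → ∀ x, IsSelfAdjoint (g f x))
    (hRbd : ∀ (f : Site P.d → 𝔸) (m : ℝ), 0 ≤ m → Bd2 P.L η k Ω f m → Bd2 P.L η k Ω (f - g (qs (c (q (g f))))) (BR * m))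
    (hRreal : ∀ f : Site P.d → 𝔸, (∀ j, j ≤ k → ∀ x ∈ Ω j, IsSelfAdjoint (f x)) →
      ∀ j, j ≤ k → ∀ x ∈ Ω j, IsSelfAdjoint ((f - g (qs (c (q (g f))))) x))
    (hDA : Bd2 P.L η k Ω (fun y => covDivB η (1 : Site P.d → Fin P.d → 𝔸ˣ) A y) cDA)
    (hDAsa : ∀ j, j ≤ k → ∀ x ∈ Ω j, IsSelfAdjoint (covDivB η (1 : Site P.d → Fin P.d → 𝔸ˣ) A x))
    (hA : ∀ j, j ≤ k → ∀ x ∈ Ω j, ∀ μ : Fin P.d,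
      wt P.L η j * ‖A x μ‖ ≤ cA ∧ wt P.L η j * ‖conjR ((1 : Site P.d → Fin P.d → 𝔸ˣ) (x - e μ) μ)⁻¹ (A (x - e μ) μ)‖ ≤ cA)
    (hAsa : ∀ x μ, IsSelfAdjoint (A x μ))
    -- (B) N05's linear restriction functional: `H′` is its right inverse on the index sites ((1.91)) and JOIN-B's `q` encodes it
    (hQH : ∀ (Y : XSpace P.d k 𝔸) (j : ℕ) (hj : j ≤ k) (y : Site P.d), y ∈ Λs j →
      QprimeIter (zdBlocking P.d P.L) (bgT P.L (1 : Site P.d → Fin P.d → 𝔸ˣ)) j (H' Y) y = Y (⟨j, Nat.lt_succ_of_le hj⟩, y))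
    (hq : ∀ (f : Site P.d → 𝔸) (j : ℕ), j ≤ k → ∀ y ∈ Λs j,
      q f j y = QprimeIter (zdBlocking P.d P.L) (bgT P.L (1 : Site P.d → Fin P.d → 𝔸ˣ)) j f y)
    -- (C) the lower family member: N05's remainder at the inverse lower gauge, rows at `j < k` in the socket's shape
    (u₁ : Site P.d → 𝔸ˣ)
    (hC121lo : ∀ j, j < k → ∀ y ∈ Λs j, ∀ μ : Site P.d → 𝔸,
      (∀ x : Site P.d, InBox (tlo P.L y j) (thi P.L y j) x → ‖μ x‖ < α₄) →
      (∀ (x : Site P.d) (κ : Fin P.d), InBox (tlo P.L y j) (thi P.L y j) x → InBox (tlo P.L y j) (thi P.L y j) (x + e κ) →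
        ‖cj ((1 : Site P.d → Fin P.d → 𝔸ˣ) x κ) (μ (x + e κ)) - μ x‖ < α₄ * ((P.L : ℝ) ^ j)⁻¹) →
      ‖Cnl P.L (1 : Site P.d → Fin P.d → 𝔸ˣ) u₁⁻¹ j μ y‖ ≤ Cb)
    (hC125lo : ∀ j, j < k → ∀ y ∈ Λs j, ∀ (μ₁ μ₂ : Site P.d → 𝔸) (m : ℝ), 0 ≤ m →
      (∀ x : Site P.d, InBox (tlo P.L y j) (thi P.L y j) x → ‖μ₁ x‖ < α₄) →
      (∀ (x : Site P.d) (κ : Fin P.d), InBox (tlo P.L y j) (thi P.L y j) x → InBox (tlo P.L y j) (thi P.L y j) (x + e κ) →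
        ‖cj ((1 : Site P.d → Fin P.d → 𝔸ˣ) x κ) (μ₁ (x + e κ)) - μ₁ x‖ < α₄ * ((P.L : ℝ) ^ j)⁻¹) →
      (∀ x : Site P.d, InBox (tlo P.L y j) (thi P.L y j) x → ‖μ₂ x‖ < α₄) →
      (∀ (x : Site P.d) (κ : Fin P.d), InBox (tlo P.L y j) (thi P.L y j) x → InBox (tlo P.L y j) (thi P.L y j) (x + e κ) →
        ‖cj ((1 : Site P.d → Fin P.d → 𝔸ˣ) x κ) (μ₂ (x + e κ)) - μ₂ x‖ < α₄ * ((P.L : ℝ) ^ j)⁻¹) →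
      (∀ x : Site P.d, InBox (tlo P.L y j) (thi P.L y j) x → ‖(μ₁ - μ₂) x‖ ≤ m) →
      (∀ (x : Site P.d) (κ : Fin P.d), InBox (tlo P.L y j) (thi P.L y j) x → InBox (tlo P.L y j) (thi P.L y j) (x + e κ) →
        ‖cj ((1 : Site P.d → Fin P.d → 𝔸ˣ) x κ) ((μ₁ - μ₂) (x + e κ)) - (μ₁ - μ₂) x‖ ≤ m * ((P.L : ℝ) ^ j)⁻¹) →
      ‖Cnl P.L (1 : Site P.d → Fin P.d → 𝔸ˣ) u₁⁻¹ j μ₁ y - Cnl P.L (1 : Site P.d → Fin P.d → 𝔸ˣ) u₁⁻¹ j μ₂ y‖ ≤ Cl * m)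
    (hCreallo : ∀ j, j < k → ∀ y ∈ Λs j, ∀ μ : Site P.d → 𝔸,
      (∀ x : Site P.d, InBox (tlo P.L y j) (thi P.L y j) x → ‖μ x‖ < α₄) →
      (∀ (x : Site P.d) (κ : Fin P.d), InBox (tlo P.L y j) (thi P.L y j) x → InBox (tlo P.L y j) (thi P.L y j) (x + e κ) →
        ‖cj ((1 : Site P.d → Fin P.d → 𝔸ˣ) x κ) (μ (x + e κ)) - μ x‖ < α₄ * ((P.L : ℝ) ^ j)⁻¹) →
      Cnl P.L (1 : Site P.d → Fin P.d → 𝔸ˣ) u₁⁻¹ j (fun x => -star (μ x)) y = -star (Cnl P.L (1 : Site P.d → Fin P.d → 𝔸ˣ) u₁⁻¹ j μ y))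
    -- (D) the torus side: the effective-gauge tower of the charted iterate, the representative, the target
    (W₁ : GaugeField P 0 𝔸ˣ) (κf : (Literature.MathematicalPhysics.QuantumFieldTheory.Balaban1983to89.Site P 0 → 𝔸) → (i : ℕ) → GaugeTransf P i 𝔸ˣ)
    (rep : Literature.MathematicalPhysics.QuantumFieldTheory.Balaban1983to89.Site P 0 → Site P.d)
    (hrep : ∀ yc ∈ Λs k, ∀ x : Site P.d, InBox (tlo P.L yc k) (thi P.L yc k) x → rep (cover P x) = x)
    (y₀ : Literature.MathematicalPhysics.QuantumFieldTheory.Balaban1983to89.Site P k)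
    (th : XSpace P.d k 𝔸) (hτ : B₀' * ‖th‖ < α₄ / 4) (hth : ∀ p, star (th p) = -th p)
    (hthk : ∀ yc ∈ Λs k, th (⟨k, Nat.lt_succ_self k⟩, yc) = mlog ((axialT (dbarIterU k W₁) y₀ (coverAt P k yc) : 𝔸ˣ) : 𝔸))
    (hthlo : ∀ (j : ℕ) (hj : j < k) (y : Site P.d), y ∈ Λs j → th (⟨j, Nat.lt_succ_of_lt hj⟩, y) = 0)
    (haxT : ∀ yc ∈ Λs k, ‖((axialT (dbarIterU k W₁) y₀ (coverAt P k yc) : 𝔸ˣ) : 𝔸) - 1‖ < 1)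
    -- the windows of JOIN-B at the Sect. E sizes (socket letters VERBATIM)
    (ha₁' : α₄ / 4 + B₀' * (Cb + ‖th‖) ≤ 1 / 24) (hb₁' : α₄ / 4 + B₀' * (Cb + ‖th‖) ≤ 1 / 140)
    (hθ : 10 * (α₄ / 4 + B₀' * (Cb + ‖th‖)) * BR ≤ 1 / 2) (hh₀' : B₀' * (Cb + ‖th‖) ≤ 3 * α₄ / 4)
    (h103 : BG * Mc P.d BR (α₄ / 4 + B₀' * (Cb + ‖th‖)) cA (B₂' * (Cb + ‖th‖)) cDA ≤ α₄ / 4)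
    (h106 : BG * Kc P.d BR (α₄ / 4 + B₀' * (Cb + ‖th‖)) cA (B₂' * (Cb + ‖th‖)) cDA (B₂' * (2 * Cl)) (1 + B₀' * (2 * Cl)) (1 + B₀' * (2 * Cl))
      ≤ 1 / 2)
    -- (E) the three top rows in torus letters on the tower box (F2∕F3∕F4-local composed with the oscillation transfer; FILE 3 discharges)
    (hTop121 : ∀ yc ∈ Λs k, ∀ l₀ : Literature.MathematicalPhysics.QuantumFieldTheory.Balaban1983to89.Site P 0 → 𝔸,
      (∀ x : Site P.d, InBox (tlo P.L yc k) (thi P.L yc k) x → ‖l₀ (cover P x)‖ ≤ α₄) →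
      (∀ (x : Site P.d) (κ : Fin P.d), InBox (tlo P.L yc k) (thi P.L yc k) x → InBox (tlo P.L yc k) (thi P.L yc k) (x + e κ) →
        ‖l₀ (cover P (x + e κ)) - l₀ (cover P x)‖ ≤ α₄ * ((P.L : ℝ) ^ k)⁻¹) →
      exp (mlog ((κf l₀ k (coverAt P k yc) : 𝔸ˣ) : 𝔸)) = ((κf l₀ k (coverAt P k yc) : 𝔸ˣ) : 𝔸) ∧
        ‖mlog ((κf l₀ k (coverAt P k yc) : 𝔸ˣ) : 𝔸) - siteAvgIter k l₀ (coverAt P k yc)‖ ≤ Cb)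
    (hTop125 : ∀ yc ∈ Λs k, ∀ (l₁ l₂ : Literature.MathematicalPhysics.QuantumFieldTheory.Balaban1983to89.Site P 0 → 𝔸) (m : ℝ), 0 ≤ m →
      (∀ x : Site P.d, InBox (tlo P.L yc k) (thi P.L yc k) x → ‖l₁ (cover P x)‖ ≤ α₄) →
      (∀ (x : Site P.d) (κ : Fin P.d), InBox (tlo P.L yc k) (thi P.L yc k) x → InBox (tlo P.L yc k) (thi P.L yc k) (x + e κ) →
        ‖l₁ (cover P (x + e κ)) - l₁ (cover P x)‖ ≤ α₄ * ((P.L : ℝ) ^ k)⁻¹) →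
      (∀ x : Site P.d, InBox (tlo P.L yc k) (thi P.L yc k) x → ‖l₂ (cover P x)‖ ≤ α₄) →
      (∀ (x : Site P.d) (κ : Fin P.d), InBox (tlo P.L yc k) (thi P.L yc k) x → InBox (tlo P.L yc k) (thi P.L yc k) (x + e κ) →
        ‖l₂ (cover P (x + e κ)) - l₂ (cover P x)‖ ≤ α₄ * ((P.L : ℝ) ^ k)⁻¹) →
      (∀ x : Site P.d, InBox (tlo P.L yc k) (thi P.L yc k) x → ‖l₁ (cover P x) - l₂ (cover P x)‖ ≤ m) →
      (∀ (x : Site P.d) (κ : Fin P.d), InBox (tlo P.L yc k) (thi P.L yc k) x → InBox (tlo P.L yc k) (thi P.L yc k) (x + e κ) →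
        ‖(l₁ (cover P (x + e κ)) - l₂ (cover P (x + e κ))) - (l₁ (cover P x) - l₂ (cover P x))‖ ≤ m * ((P.L : ℝ) ^ k)⁻¹) →
      ‖(mlog ((κf l₁ k (coverAt P k yc) : 𝔸ˣ) : 𝔸) - siteAvgIter k l₁ (coverAt P k yc)) -
          (mlog ((κf l₂ k (coverAt P k yc) : 𝔸ˣ) : 𝔸) - siteAvgIter k l₂ (coverAt P k yc))‖ ≤ Cl * m)
    (hTopReal : ∀ yc ∈ Λs k, ∀ l₀ : Literature.MathematicalPhysics.QuantumFieldTheory.Balaban1983to89.Site P 0 → 𝔸,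
      (∀ x : Site P.d, InBox (tlo P.L yc k) (thi P.L yc k) x → ‖l₀ (cover P x)‖ ≤ α₄) →
      (∀ (x : Site P.d) (κ : Fin P.d), InBox (tlo P.L yc k) (thi P.L yc k) x → InBox (tlo P.L yc k) (thi P.L yc k) (x + e κ) →
        ‖l₀ (cover P (x + e κ)) - l₀ (cover P x)‖ ≤ α₄ * ((P.L : ℝ) ^ k)⁻¹) →
      mlog ((κf (fun s => -star (l₀ s)) k (coverAt P k yc) : 𝔸ˣ) : 𝔸) - siteAvgIter k (fun s => -star (l₀ s)) (coverAt P k yc) =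
        -star (mlog ((κf l₀ k (coverAt P k yc) : 𝔸ˣ) : 𝔸) - siteAvgIter k l₀ (coverAt P k yc))) :
    ∃ lam : Site P.d → 𝔸, (∀ x, IsSelfAdjoint (lam x)) ∧ (∀ x, x ∉ Ω 0 → lam x = 0) ∧
      (∀ j, j ≤ k → ∀ p ∈ Eb j, ‖lam p.1‖ ≤ α₄ ∧ wt P.L η j * ‖covDerivFwd η (1 : Site P.d → Fin P.d → 𝔸ˣ) p.2 lam p.1‖ ≤ α₄) ∧
      (∃ μ : ℕ → Site P.d → 𝔸, ∀ x ∈ Ω 0,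
        covLap η (1 : Site P.d → Fin P.d → 𝔸ˣ) ((Ω 0).indicator fun y =>
          covDivB η (1 : Site P.d → Fin P.d → 𝔸ˣ) A y + covLap η (1 : Site P.d → Fin P.d → 𝔸ˣ) lam y +
          ((conjR (gaugeExp lam y)⁻¹ (covDivB η (1 : Site P.d → Fin P.d → 𝔸ˣ) A y) - covDivB η (1 : Site P.d → Fin P.d → 𝔸ˣ) A y) +
            (gAd (covLap η (1 : Site P.d → Fin P.d → 𝔸ˣ) lam y) (lam y) - covLap η (1 : Site P.d → Fin P.d → 𝔸ˣ) lam y) +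
            ∑ μ, frakF3 η (1 : Site P.d → Fin P.d → 𝔸ˣ) lam A y μ)) x = QT P.L k Λs (1 : Site P.d → Fin P.d → 𝔸ˣ) μ x) ∧
      (∀ j, j < k → ∀ y ∈ Λs j, Qnl P.L (1 : Site P.d → Fin P.d → 𝔸ˣ) (fun x => expUnit (((-I) • lam) x)) u₁⁻¹ j y = 0) ∧
      (∀ yc ∈ Λs k, κf (((-I) • lam) ∘ rep) k (coverAt P k yc) = axialT (dbarIterU k W₁) y₀ (coverAt P k yc)) := by
  have hL : 1 ≤ P.L := P.L_pos
  -- the instance: N05's linear functional, the lower∕top split of the family and of the full functional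
  let Qlin : ℕ → (Site P.d → 𝔸) → Site P.d → 𝔸 := fun j μ y =>
    QprimeIter (zdBlocking P.d P.L) (bgT P.L (1 : Site P.d → Fin P.d → 𝔸ˣ)) j μ y
  let Ctop : (Site P.d → 𝔸) → Site P.d → 𝔸 := fun μ yc =>
    mlog ((κf (μ ∘ rep) k (coverAt P k yc) : 𝔸ˣ) : 𝔸) - siteAvgIter k (μ ∘ rep) (coverAt P k yc)
  let Cfam : ℕ → (Site P.d → 𝔸) → Site P.d → 𝔸 := fun j μ y =>
    if j < k then Cnl P.L (1 : Site P.d → Fin P.d → 𝔸ˣ) u₁⁻¹ j μ y else Ctop μ y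
  let Qfull : ℕ → (Site P.d → 𝔸) → Site P.d → 𝔸 := fun j μ y =>
    if j < k then Qnl P.L (1 : Site P.d → Fin P.d → 𝔸ˣ) (fun x => expUnit (μ x)) u₁⁻¹ j y
    else mlog ((κf (μ ∘ rep) k (coverAt P k y) : 𝔸ˣ) : 𝔸)
  -- the top-box hypotheses of the socket, transported to the torus field `μ ∘ rep` through `hrep` (`cj 1 = id`)
  have trb : ∀ yc ∈ Λs k, ∀ (μ : Site P.d → 𝔸) (t : ℝ),
      (∀ x : Site P.d, InBox (tlo P.L yc k) (thi P.L yc k) x → ‖μ x‖ < t) →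
      ∀ x : Site P.d, InBox (tlo P.L yc k) (thi P.L yc k) x → ‖(μ ∘ rep) (cover P x)‖ ≤ t := by
    intro yc hyc μ t hb x hx
    rw [Function.comp_apply, hrep yc hyc x hx]; exact (hb x hx).le
  have trb' : ∀ yc ∈ Λs k, ∀ (μ : Site P.d → 𝔸) (t : ℝ),
      (∀ x : Site P.d, InBox (tlo P.L yc k) (thi P.L yc k) x → ‖μ x‖ ≤ t) →
      ∀ x : Site P.d, InBox (tlo P.L yc k) (thi P.L yc k) x → ‖(μ ∘ rep) (cover P x)‖ ≤ t := by
    intro yc hyc μ t hb x hx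
    rw [Function.comp_apply, hrep yc hyc x hx]; exact hb x hx
  have tra : ∀ yc ∈ Λs k, ∀ (μ : Site P.d → 𝔸) (t : ℝ),
      (∀ (x : Site P.d) (κ : Fin P.d), InBox (tlo P.L yc k) (thi P.L yc k) x → InBox (tlo P.L yc k) (thi P.L yc k) (x + e κ) →
        ‖cj ((1 : Site P.d → Fin P.d → 𝔸ˣ) x κ) (μ (x + e κ)) - μ x‖ < t) →
      ∀ (x : Site P.d) (κ : Fin P.d), InBox (tlo P.L yc k) (thi P.L yc k) x → InBox (tlo P.L yc k) (thi P.L yc k) (x + e κ) →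
        ‖(μ ∘ rep) (cover P (x + e κ)) - (μ ∘ rep) (cover P x)‖ ≤ t := by
    intro yc hyc μ t ha x κ hx hxe
    have h := ha x κ hx hxe
    rw [Pi.one_apply, Pi.one_apply, cj_one_apply] at h
    rw [Function.comp_apply, Function.comp_apply, hrep yc hyc _ hxe, hrep yc hyc x hx]; exact h.le
  have tra' : ∀ yc ∈ Λs k, ∀ (μ : Site P.d → 𝔸) (t : ℝ),
      (∀ (x : Site P.d) (κ : Fin P.d), InBox (tlo P.L yc k) (thi P.L yc k) x → InBox (tlo P.L yc k) (thi P.L yc k) (x + e κ) →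
        ‖cj ((1 : Site P.d → Fin P.d → 𝔸ˣ) x κ) (μ (x + e κ)) - μ x‖ ≤ t) →
      ∀ (x : Site P.d) (κ : Fin P.d), InBox (tlo P.L yc k) (thi P.L yc k) x → InBox (tlo P.L yc k) (thi P.L yc k) (x + e κ) →
        ‖(μ ∘ rep) (cover P (x + e κ)) - (μ ∘ rep) (cover P x)‖ ≤ t := by
    intro yc hyc μ t ha x κ hx hxe
    have h := ha x κ hx hxe
    rw [Pi.one_apply, Pi.one_apply, cj_one_apply] at h
    rw [Function.comp_apply, Function.comp_apply, hrep yc hyc _ hxe, hrep yc hyc x hx]; exact h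
  -- the (S2) dictionary at the top index sites
  have hS2 : ∀ yc ∈ Λs k, ∀ μ : Site P.d → 𝔸,
      siteAvgIter k (μ ∘ rep) (coverAt P k yc) = QprimeIter (zdBlocking P.d P.L) (bgT P.L (1 : Site P.d → Fin P.d → 𝔸ˣ)) k μ yc := by
    intro yc hyc μ
    exact siteAvgIter_comp_rep_coverAt_eq_qprimeIter hk μ rep yc fun x hx =>
      hrep yc hyc x ((inBox_tlo_thi_iff_mem_blockSites hL k yc x).2 hx)
  -- the family's rows: lower levels = N05's, top = the torus rows through the dictionary
  have h121 : ∀ j, j ≤ k → ∀ y ∈ Λs j, ∀ μ : Site P.d → 𝔸,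
      (∀ x : Site P.d, InBox (tlo P.L y j) (thi P.L y j) x → ‖μ x‖ < α₄) →
      (∀ (x : Site P.d) (κ : Fin P.d), InBox (tlo P.L y j) (thi P.L y j) x → InBox (tlo P.L y j) (thi P.L y j) (x + e κ) →
        ‖cj ((1 : Site P.d → Fin P.d → 𝔸ˣ) x κ) (μ (x + e κ)) - μ x‖ < α₄ * ((P.L : ℝ) ^ j)⁻¹) →
      ‖Cfam j μ y‖ ≤ Cb := by
    intro j hj y hy μ hb ha
    by_cases hjk : j < k
    · simp only [Cfam, hjk, if_true]; exact hC121lo j hjk y hy μ hb ha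
    · obtain rfl : j = k := le_antisymm hj (not_lt.1 hjk)
      simp only [Cfam, lt_irrefl, if_false, Ctop]
      exact (hTop121 y hy (μ ∘ rep) (trb y hy μ _ hb) (tra y hy μ _ ha)).2
  have h125 : ∀ j, j ≤ k → ∀ y ∈ Λs j, ∀ (μ₁ μ₂ : Site P.d → 𝔸) (m : ℝ), 0 ≤ m →
      (∀ x : Site P.d, InBox (tlo P.L y j) (thi P.L y j) x → ‖μ₁ x‖ < α₄) →
      (∀ (x : Site P.d) (κ : Fin P.d), InBox (tlo P.L y j) (thi P.L y j) x → InBox (tlo P.L y j) (thi P.L y j) (x + e κ) →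
        ‖cj ((1 : Site P.d → Fin P.d → 𝔸ˣ) x κ) (μ₁ (x + e κ)) - μ₁ x‖ < α₄ * ((P.L : ℝ) ^ j)⁻¹) →
      (∀ x : Site P.d, InBox (tlo P.L y j) (thi P.L y j) x → ‖μ₂ x‖ < α₄) →
      (∀ (x : Site P.d) (κ : Fin P.d), InBox (tlo P.L y j) (thi P.L y j) x → InBox (tlo P.L y j) (thi P.L y j) (x + e κ) →
        ‖cj ((1 : Site P.d → Fin P.d → 𝔸ˣ) x κ) (μ₂ (x + e κ)) - μ₂ x‖ < α₄ * ((P.L : ℝ) ^ j)⁻¹) →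
      (∀ x : Site P.d, InBox (tlo P.L y j) (thi P.L y j) x → ‖(μ₁ - μ₂) x‖ ≤ m) →
      (∀ (x : Site P.d) (κ : Fin P.d), InBox (tlo P.L y j) (thi P.L y j) x → InBox (tlo P.L y j) (thi P.L y j) (x + e κ) →
        ‖cj ((1 : Site P.d → Fin P.d → 𝔸ˣ) x κ) ((μ₁ - μ₂) (x + e κ)) - (μ₁ - μ₂) x‖ ≤ m * ((P.L : ℝ) ^ j)⁻¹) →
      ‖Cfam j μ₁ y - Cfam j μ₂ y‖ ≤ Cl * m := by
    intro j hj y hy μ₁ μ₂ m hm h1b h1a h2b h2a hmb hma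
    by_cases hjk : j < k
    · simp only [Cfam, hjk, if_true]; exact hC125lo j hjk y hy μ₁ μ₂ m hm h1b h1a h2b h2a hmb hma
    · obtain rfl : j = k := le_antisymm hj (not_lt.1 hjk)
      simp only [Cfam, lt_irrefl, if_false, Ctop]
      have hmb' : ∀ x : Site P.d, InBox (tlo P.L y j) (thi P.L y j) x → ‖(μ₁ ∘ rep) (cover P x) - (μ₂ ∘ rep) (cover P x)‖ ≤ m := by
        intro x hx
        have h := trb' y hy (μ₁ - μ₂) m hmb x hx
        simpa only [Function.comp_apply, Pi.sub_apply] using h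
      have hma' : ∀ (x : Site P.d) (κ : Fin P.d), InBox (tlo P.L y j) (thi P.L y j) x → InBox (tlo P.L y j) (thi P.L y j) (x + e κ) →
          ‖((μ₁ ∘ rep) (cover P (x + e κ)) - (μ₂ ∘ rep) (cover P (x + e κ))) - ((μ₁ ∘ rep) (cover P x) - (μ₂ ∘ rep) (cover P x))‖ ≤
            m * ((P.L : ℝ) ^ j)⁻¹ := by
        intro x κ hx hxe
        have h := tra' y hy (μ₁ - μ₂) (m * ((P.L : ℝ) ^ j)⁻¹) hma x κ hx hxe
        simpa only [Function.comp_apply, Pi.sub_apply] using h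
      exact hTop125 y hy (μ₁ ∘ rep) (μ₂ ∘ rep) m hm (trb y hy μ₁ _ h1b) (tra y hy μ₁ _ h1a) (trb y hy μ₂ _ h2b) (tra y hy μ₂ _ h2a)
        hmb' hma'
  have hreal : ∀ j, j ≤ k → ∀ y ∈ Λs j, ∀ μ : Site P.d → 𝔸,
      (∀ x : Site P.d, InBox (tlo P.L y j) (thi P.L y j) x → ‖μ x‖ < α₄) →
      (∀ (x : Site P.d) (κ : Fin P.d), InBox (tlo P.L y j) (thi P.L y j) x → InBox (tlo P.L y j) (thi P.L y j) (x + e κ) →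
        ‖cj ((1 : Site P.d → Fin P.d → 𝔸ˣ) x κ) (μ (x + e κ)) - μ x‖ < α₄ * ((P.L : ℝ) ^ j)⁻¹) →
      Cfam j (fun x => -star (μ x)) y = -star (Cfam j μ y) := by
    intro j hj y hy μ hb ha
    by_cases hjk : j < k
    · simp only [Cfam, hjk, if_true]; exact hCreallo j hjk y hy μ hb ha
    · obtain rfl : j = k := le_antisymm hj (not_lt.1 hjk)
      simp only [Cfam, lt_irrefl, if_false, Ctop]
      exact hTopReal y hy (μ ∘ rep) (trb y hy μ _ hb) (tra y hy μ _ ha)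
  -- the split `Qfull = Qlin + Cfam` ((1.113): definitional below the top, (S2) at the top), additivity, the kernel row
  have h213 : ∀ (j : ℕ), j ≤ k → ∀ y ∈ Λs j, ∀ μ : Site P.d → 𝔸, Qfull j μ y = Qlin j μ y + Cfam j μ y := by
    intro j hj y hy μ
    by_cases hjk : j < k
    · simp only [Qfull, Cfam, Qlin, hjk, if_true, Cnl]
      abel
    · obtain rfl : j = k := le_antisymm hj (not_lt.1 hjk)
      simp only [Qfull, Cfam, Qlin, lt_irrefl, if_false, Ctop]
      rw [hS2 y hy μ]
      abel
  have hlin : ∀ (j : ℕ) (μ₁ μ₂ : Site P.d → 𝔸) (y : Site P.d), Qlin j (μ₁ - μ₂) y = Qlin j μ₁ y - Qlin j μ₂ y :=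
    fun j μ₁ μ₂ y => qprimeIter_sub _ _ j μ₁ μ₂ y
  have hQlin0 : ∀ lam : Site P.d → 𝔸, q lam = 0 → ∀ (j : ℕ), j ≤ k → ∀ y ∈ Λs j, Qlin j ((-I) • lam) y = 0 := by
    intro lam hq0 j hj y hy
    show QprimeIter (zdBlocking P.d P.L) (bgT P.L (1 : Site P.d → Fin P.d → 𝔸ˣ)) j ((-I) • lam) y = 0
    rw [← hq ((-I) • lam) j hj y hy, map_smul, hq0, smul_zero, Pi.zero_apply, Pi.zero_apply]
  -- the socket
  obtain ⟨lam, hsa, hsupp, h108, hmult, hQ⟩ := hFP_kLevel_family_RD (U₀ := (1 : Site P.d → Fin P.d → 𝔸ˣ)) hL hη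
    (fun _ _ => (unitaryUnits 𝔸).one_mem) hEbΩ hEbT g Δ q qs Aw c g_rightΩ c_range hΔ hqs H' hα₄ hB hB₂ hCb hCl hH0 hH1 hH2 hHsupp hHequiv
    Cfam h121 h125 hreal hCbρ hClB th hτ hth Qfull Qlin h213 hlin hQH hQlin0 hBG hBR hcA hcA' hcDA ha₁' hb₁' hθ hh₀' hG hGsupp hGreal hRbd
    hRreal hDA hDAsa hA hAsa h103 h106
  refine ⟨lam, hsa, hsupp, h108, hmult, fun j hj y hy => ?_, fun yc hyc => ?_⟩
  · -- (lo): below the top the target vanishes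
    have h := hQ j hj.le y hy
    simp only [Qfull, hj, if_true, hthlo j hj y hy] at h
    exact h
  · -- (top): both sides are exponentials of their logarithms
    have h := hQ k le_rfl yc hyc
    simp only [Qfull, lt_irrefl, if_false, hthk yc hyc] at h
    -- the box bounds of `(−I)•λ′` from (1.108): sup everywhere, gradient on the top box
    have hsup : ∀ x : Site P.d, ‖((-I) • lam) x‖ ≤ α₄ := by
      intro x
      rw [Pi.smul_apply, norm_smul, norm_neg, Complex.norm_I, one_mul]
      by_cases hx : x ∈ Ω 0
      · exact ((h108 0 (Nat.zero_le k) (x, ⟨0, P.hd⟩) (hEbΩ 0 (Nat.zero_le k) x hx ⟨0, P.hd⟩).1).1)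
      · rw [hsupp x hx, norm_zero]; exact hα₄.le
    have hgrad : ∀ (x : Site P.d) (κ : Fin P.d), InBox (tlo P.L yc k) (thi P.L yc k) x → InBox (tlo P.L yc k) (thi P.L yc k) (x + e κ) →
        ‖cj ((1 : Site P.d → Fin P.d → 𝔸ˣ) x κ) (((-I) • lam) (x + e κ)) - ((-I) • lam) x‖ ≤ α₄ * ((P.L : ℝ) ^ k)⁻¹ := by
      intro x κ hx hxe
      have hE : (x, κ) ∈ Eb k := hEbT k le_rfl yc hyc x κ hx hxe
      have h2 := (h108 k le_rfl (x, κ) hE).2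
      -- `wt L η k · ‖η⁻¹(λ(x+e_κ) − λ x)‖ ≤ α₄` ⇒ `‖λ(x+e_κ) − λ x‖ ≤ α₄ L^{−k}`
      have hLk : (0 : ℝ) < (P.L : ℝ) ^ k := by positivity
      have hcd : covDerivFwd η (1 : Site P.d → Fin P.d → 𝔸ˣ) κ lam x = η⁻¹ • (lam (x + e κ) - lam x) := by
        simp only [covDerivFwd, Pi.one_apply, B7Eq78Linearization.conjR_apply, Units.val_one, inv_one, one_mul, mul_one]
      rw [hcd, norm_smul, Real.norm_of_nonneg (inv_nonneg.2 hη.le), wt] at h2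
      have h3 : ‖lam (x + e κ) - lam x‖ ≤ α₄ * ((P.L : ℝ) ^ k)⁻¹ := by
        rw [le_mul_inv_iff₀ hLk]
        have : (P.L : ℝ) ^ k * η * (η⁻¹ * ‖lam (x + e κ) - lam x‖) = ‖lam (x + e κ) - lam x‖ * (P.L : ℝ) ^ k := by
          field_simp
        linarith [this ▸ h2]
      rw [Pi.one_apply, Pi.one_apply, cj_one_apply, Pi.smul_apply, Pi.smul_apply, ← smul_sub, norm_smul, norm_neg, Complex.norm_I, one_mul]
      exact h3
    have hexpκ := (hTop121 yc hyc (((-I) • lam) ∘ rep) (trb' yc hyc _ _ fun x _ => hsup x) (tra' yc hyc _ _ hgrad)).1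
    have hexpA : exp (mlog ((axialT (dbarIterU k W₁) y₀ (coverAt P k yc) : 𝔸ˣ) : 𝔸)) =
        ((axialT (dbarIterU k W₁) y₀ (coverAt P k yc) : 𝔸ˣ) : 𝔸) := MatrixLog.exp_mlog (haxT yc hyc)
    apply Units.ext
    rw [← hexpκ, h, hexpA]

end Summit.QuantumFields.YangMills.Theorems.P1FlatCoreTopStepTorus

end
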